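import Literature.MathematicalPhysics.QuantumFieldTheory.Balaban1983to89.B13Lemma1BlocksTorus
import Literature.MathematicalPhysics.QuantumFieldTheory.Balaban1983to89.B13LeafTorus
import Literature.MathematicalPhysics.QuantumFieldTheory.Balaban1983to89.B13Lemma3TorusNonvacuity

/-!
# `Balaban1983to89.B13NodeTorusConsts` — T. Bałaban, *Renormalization group approach to lattice gauge field theories.
II. Cluster expansions*, Commun. Math. Phys. **116** (1988) 1–22 [Balaban1988RG2Cluster]: **the Lemma-3 witness
constants `B13Lemma3TorusNonvacuity.consts` ALSO meet every numerical threshold of the Lemma-1 ∕ leaf theorems of node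
N10** — one assignment of `B13.Consts` for both halves of the node's located hypothesis list

statement-level skeleton of published theorems with citation tags; proofs where landed; nothing here is a claim about
the Yang–Mills mass gap

CITATION HEADER / WHAT IS REPRODUCED (cell `pub-ymgap`, Track A node N10 = [B13], prover seat `pub-ymgap-dag-p2`,
fourteenth module; a NEW LEAF over `B13Lemma1BlocksTorus`, `B13LeafTorus`, `B13Lemma3TorusNonvacuity`, nothing there
modified).  p. 21, verbatim: *"The assumptions allow finally us to fix all the constants, or rather bounds on these
constants."*  The node theorem `B13NodeTorus.b13_main_twoTorus_located_of_226` carries TWO families of numerical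
hypotheses on the same `c : B13.Consts`: the Lemma-1 ∕ Lemma-2 thresholds of this seat (κ, δκ ≥ κ₀(64, 8); κ₁ floors;
δ₀M ≥ 10e⁻¹, 2 log 5; δκ ≥ 1; δ < 1; R8; R9; the constant inequality of (1.36) with K = K′ = 0) and the Lemma-3
numerics of `B13Lemma3Torus.bound238_torus` (R15–R20, (2.29)/(2.31) smallness, the O(1)'s), whose satisfiability is
`B13Lemma3TorusNonvacuity.numerics_nonvacuous` — witnessed THERE (by inspection of its proof term) by the public
assignment `B13Lemma3TorusNonvacuity.consts` (L = 8, δ = 3/40, κ = 20(κ₀(64,8) + 64), κ₁ = 1 + 36(1 − 7δ)·4κ, δ₀ = 1,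
M = κ + 1, E₀ = 2, C₁ = C₂ = α₄ = 1, q = 0, ε₁ = ε₁t > 0).  THIS MODULE PROVES that the SAME `consts` meets every
threshold of the first family (`consts_meets_lemma1_thresholds`) and that the Lemma-1 ∕ leaf theorems APPLY at
`consts` on the two-scale torus `TwoTorusStep 4 8 2` with the all-zero datum (`leaf_at_consts`), so that ONE assignment
serves both halves.  (A single kernel theorem «all hypotheses of `…_of_226` hold at consts» would additionally need the
per-hypothesis lemmas of `B13Lemma3TorusNonvacuity`, which are private to that file — recorded as a follow-up for its
owner; nothing here re-proves them.)  The witness says nothing about the size of the physical constants.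
HONEST FRAMING: a count-neutral Track-A side landing (YM-PLAN §1); NOT a discharge of node N10; nothing continuum /
OS / mass-gap / Clay.
-/

noncomputable section

namespace Literature.MathematicalPhysics.QuantumFieldTheory.Balaban1983to89.B13NodeTorusConsts

open Literature.MathematicalPhysics.QuantumFieldTheory.Balaban1983to89
open Literature.MathematicalPhysics.QuantumFieldTheory.Balaban1983to89.B13ScaleTransfer (Pt)
open Literature.MathematicalPhysics.QuantumFieldTheory.Balaban1983to89.B16Absorption (pbox)
open Literature.MathematicalPhysics.QuantumFieldTheory.Balaban1983to89.TreeLengthTorus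
open Literature.MathematicalPhysics.QuantumFieldTheory.Balaban1983to89.TreeLengthTorusTransfer (tcoarse)
open Literature.MathematicalPhysics.QuantumFieldTheory.Balaban1983to89.B12TreeDecay (kappa₀ K₀ K₀_pos kappa₀_nonneg)
open Literature.MathematicalPhysics.QuantumFieldTheory.Balaban1983to89.B13Lemma3Torus (TwoTorusStep)
open Literature.MathematicalPhysics.QuantumFieldTheory.Balaban1983to89.B13Lemma3WindowNonvacuity
  (Kw κ₀w κw δw μw α₆w Aup A₁w A₂w ε₂w)
open Literature.MathematicalPhysics.QuantumFieldTheory.Balaban1983to89.B13Lemma3TorusNonvacuity (consts κ₁t ε₁t)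
open Literature.MathematicalPhysics.QuantumFieldTheory.Balaban1983to89.B13CubeSumTorus (image_pbox_eq_univ)
open Literature.MathematicalPhysics.QuantumFieldTheory.Balaban1983to89.B13Lemma1BlocksTorus (lemma1Printed_twoTorus_blocks)
open Literature.MathematicalPhysics.QuantumFieldTheory.Balaban1983to89.B13LeafTorus (b13Leaf_twoTorus)

/-! ## §1. Elementary facts about the witness (re-derived; the owner's are private) -/

/-- κ := 20(κ₀ + 64) ≥ 1280 and ≥ κ₀ + 64.  Private plumbing. [folklore] -/
private theorem κw_ge : 1280 ≤ κw ∧ κ₀w + 64 ≤ κw := by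
  have h0 : 0 ≤ κ₀w := kappa₀_nonneg (by norm_num) 8
  unfold κw; constructor <;> nlinarith

/-- μw = (19/10)·κw.  Private plumbing. [folklore] -/
private theorem μw_eq : μw = (19 / 10) * κw := by
  unfold μw δw; ring

/-- ε₁t > 0 (all factors of ε₂w, α₆w positive).  Private plumbing. [folklore] -/
private theorem ε₁t_pos : 0 < ε₁t := by
  have hK : 0 < Kw := K₀_pos 64 8
  have hα : 0 < α₆w := by unfold α₆w; positivity
  have hAup : 0 < Aup := by unfold Aup; positivity
  have hA₁ : 0 < A₁w := by unfold A₁w; positivity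
  have hA₂ : 0 < A₂w := by unfold A₂w; positivity
  have hε₂ : 0 < ε₂w := by unfold ε₂w; positivity
  unfold ε₁t; positivity

/-! ## §2. The Lemma-1 ∕ leaf thresholds at the Lemma-3 witness -/

/-- **`B13Lemma3TorusNonvacuity.consts` MEETS EVERY NUMERICAL THRESHOLD OF THE LEMMA-1 ∕ LEAF THEOREMS** of
`B13Lemma1BlocksTorus.lemma1Printed_twoTorus_blocks` ∕ `B13NodeTorus.b13_main_twoTorus_located(_of_226)` (with K = K′ = 0
in the constant inequality): L = 8 ≥ 2 with 8·2 ≥ 12; κ, δκ ≥ κ₀(64, 8); 0 ≤ κ; δ = 3/40 < 1; δκ ≥ 1; κ₁ = 1 + 68.4κ ≥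
the two floors; δ₀M = κ + 1 ≥ 10e⁻¹, 2 log 5; R8; R9; 0 < E₀ε₁C₁M^q e^{C₂κ₁}; 0 ≤ ε₁, C₃.  p. 21: *"The assumptions
allow finally us to fix all the constants"*. [cite: Balaban1988RG2Cluster, p.21 (closing paragraph: the constants can be fixed)] -/
theorem consts_meets_lemma1_thresholds :
    consts.L = 8 ∧ 12 ≤ consts.L * 2 ∧ kappa₀ 64 8 ≤ consts.κ ∧ kappa₀ 64 8 ≤ consts.δ * consts.κ ∧ 0 ≤ consts.κ ∧
    consts.δ < 1 ∧ 1 ≤ consts.δ * consts.κ ∧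
    1 + 2 * Real.log (8 * 12 ^ 3) ≤ consts.κ₁ ∧ 2 + 16 * Real.log 128 ≤ consts.κ₁ ∧
    10 * Real.exp (-1) ≤ consts.δ₀ * consts.M ∧ 2 * Real.log 5 ≤ consts.δ₀ * consts.M ∧
    (1 - consts.δ) * consts.κ ≤ (1 / 4) * (consts.κ₁ - 1) ∧ (1 - 2 * consts.δ) * consts.κ ≤ (1 / 16) * consts.κ₁ ∧
    0 < consts.E₀ * consts.ε₁ * consts.C₁ * consts.M ^ consts.q * Real.exp (consts.C₂ * consts.κ₁) ∧
    0 ≤ consts.ε₁ ∧ 0 ≤ consts.C₃ := by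
  obtain ⟨hκ1280, hκκ₀⟩ := κw_ge
  have h0 : 0 ≤ κ₀w := kappa₀_nonneg (by norm_num) 8
  have hκ₀ : kappa₀ 64 8 = κ₀w := rfl
  have hμ := μw_eq
  have hε₁ := ε₁t_pos
  have hκw : κw = 20 * (κ₀w + 64) := rfl
  have hlog1 : Real.log (8 * 12 ^ 3) ≤ 13824 := by
    have := Real.log_le_sub_one_of_pos (show (0:ℝ) < 8 * 12 ^ 3 by norm_num); norm_num at this ⊢; linarith
  have hlog2 : Real.log 128 ≤ 128 := by
    have := Real.log_le_sub_one_of_pos (show (0:ℝ) < 128 by norm_num); linarith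
  have hlog5 : Real.log 5 ≤ 5 := by
    have := Real.log_le_sub_one_of_pos (show (0:ℝ) < 5 by norm_num); linarith
  have hexp1 : Real.exp (-1) ≤ 1 := Real.exp_le_one_iff.mpr (by norm_num)
  refine ⟨rfl, by show 12 ≤ 8 * 2; norm_num, ?_, ?_, ?_, ?_, ?_, ?_, ?_, ?_, ?_, ?_, ?_, ?_, ?_, ?_⟩
  · show kappa₀ 64 8 ≤ κw; rw [hκ₀]; linarith
  · show kappa₀ 64 8 ≤ δw * κw; unfold δw; rw [hκ₀]; linarith
  · show (0 : ℝ) ≤ κw; linarith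
  · show δw < 1; unfold δw; norm_num
  · show (1 : ℝ) ≤ δw * κw; unfold δw; linarith
  · show 1 + 2 * Real.log (8 * 12 ^ 3) ≤ κ₁t; unfold κ₁t; rw [hμ]
    generalize Real.log (8 * 12 ^ 3) = Lg at *
    linarith
  · show 2 + 16 * Real.log 128 ≤ κ₁t; unfold κ₁t; rw [hμ]
    generalize Real.log 128 = Lg at *
    linarith
  · show 10 * Real.exp (-1) ≤ 1 * (κw + 1)
    generalize Real.exp (-1) = E at *
    linarith
  · show 2 * Real.log 5 ≤ 1 * (κw + 1)
    generalize Real.log 5 = Lg at *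
    linarith
  · show (1 - δw) * κw ≤ (1 / 4) * (κ₁t - 1); unfold κ₁t δw; rw [hμ]; linarith
  · show (1 - 2 * δw) * κw ≤ (1 / 16) * κ₁t; unfold κ₁t δw; rw [hμ]; linarith
  · show (0 : ℝ) < 2 * ε₁t * 1 * (κw + 1) ^ (0 : ℕ) * Real.exp (1 * κ₁t); positivity
  · show (0 : ℝ) ≤ ε₁t; exact hε₁.le
  · show (0 : ℝ) ≤ 1; norm_num

/-! ## §3. The Lemma-1 ∕ leaf theorems apply at the witness -/

/-- **THE LEMMA-1 ∕ LEAF THEOREMS APPLY AT `consts`** on the two-scale torus `TwoTorusStep 4 8 2` (8·2 = 16 ≥ 12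
cubes of π_k per direction) with the all-zero step datum (M⁻⁴|Y| := #Y), empty index families, K = K′ = 0, (1.43) and (2.38) holding
trivially: the B13 leaf triple at `consts` is obtained THROUGH `lemma1Printed_twoTorus_blocks` and `b13Leaf_twoTorus`
(the proof term discharges each of their hypotheses at the witness).  Together with `B13Lemma3TorusNonvacuity` (same
`consts`) this exhibits one assignment serving both halves of `B13NodeTorus.b13_main_twoTorus_located_of_226`'s numeric
hypotheses. [cite: Balaban1988RG2Cluster, p.21 (closing paragraph: the constants can be fixed)] -/
theorem leaf_at_consts : ∃ W : TwoTorusStep 4 8 2,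
    B13.Lemma1Printed W.toStepData consts ∧ B13.Lemma2Printed W.toStepData consts ∧
      B13.Lemma3Printed W.toStepData consts := by
  obtain ⟨hL, hN12, hκ126, hκ126', hκ, hδ1, hδκ, hκ₁, hκ₁', hδ₀M, hδ₀M5, hR8, hR9, hRHS, hε₁, hC₃⟩ :=
    consts_meets_lemma1_thresholds
  let W : TwoTorusStep 4 8 2 :=
    { volk := fun Y => Y.1.card, Φ := Unit, Bond := Unit, sp1 := fun _ => Set.univ, sp2 := fun _ => Set.univ,
      Bv := fun _ _ => 0, Vp := fun _ _ => 0, V := fun _ _ => 0, Q := fun _ _ _ _ => 0, Vpp := fun _ _ => 0,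
      H := fun _ _ => 0, Ek1 := fun _ _ => 0, Elog := fun _ _ => 0, Analytic := fun _ _ => True,
      GaugeInv := fun _ => True, Repr17 := True, Restr := True }
  have hM : consts.M = κw + 1 := rfl
  have hκw : (0 : ℝ) ≤ κw := hκ
  -- Lemma 1 through `lemma1Printed_twoTorus_blocks` (k = 0, empty families, K = K′ = 0, dist ≡ 17·(κ + 1))
  have h1 : B13.Lemma1Printed W.toStepData consts := by
    refine lemma1Printed_twoTorus_blocks W consts 0 hN12 (fun _ => ∅) (fun _ _ => ∅) (fun _ _ _ => ∅)
      (fun _ _ _ _ => ∅) (fun _ _ _ _ _ _ _ => 0) (fun _ => ∅) (fun _ _ _ => ∅) (fun _ _ _ _ => ∅)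
      (fun _ _ _ _ _ _ => 0) (fun _ _ _ _ => 17 * (κw + 1)) (K := 0) (K' := 0) ?_ ?_ ?_ ?_ ?_ ?_ ?_ ?_ ?_ ?_ ?_ ?_ ?_ ?_
      le_rfl le_rfl (by norm_num) hκ hδ1 hδκ hκ126 hκ126' hκ₁ hκ₁' hδ₀M hδ₀M5 hR8 hR9 ?_ ?_ ?_
    · intro Y; simp only [Finset.sum_empty, add_zero]; rfl
    · intro Y a ha; simp at ha
    · intro Y a; exact Finset.empty_subset _
    · intro Y a ha; simp at ha
    · intro Y; exact Finset.empty_subset _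
    · intro Y a j q; show (0 : ℝ) ≤ 1 * (17 * (κw + 1)); positivity
    · intro Y a j n q hq
      show (1 : ℝ) * (κw + 1) * ((n : ℝ) + 1) ≤ 1 * (17 * (κw + 1))
      rcases le_or_gt n 16 with hn | hn
      · have : (n : ℝ) ≤ 16 := by exact_mod_cast hn
        nlinarith
      · exfalso
        apply hq
        have hcover := image_pbox_eq_univ (8 ^ (0 - j) * (8 * 2))
          (lo := fun i => ((8 ^ (0 - j) : ℕ) : ℤ) * natLift a i - (n + 1 : ℕ))
          (hi := fun i => ((8 ^ (0 - j) : ℕ) : ℤ) * natLift a i + 2 * ((8 ^ (0 - j) : ℕ) : ℤ) - 1 + (n + 1 : ℕ))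
          (fun i => by push_cast; simp; omega)
        rw [hcover]
        exact Finset.mem_univ _
    · intro Y a j q; exact Finset.empty_subset _
    · intro Y a j q; exact Finset.empty_subset _
    · intro Y a ha; simp at ha
    · intro s f g _ _; trivial
    · intro s; trivial
    · intro Y a ha; simp at ha
    · intro Y a ha; simp at ha
    · intro Y φ _ a ha; simp at ha
    · intro Y φ _ a ha; simp at ha
    · have := hRHS.le
      simpa using this
  -- Lemma 2 inputs and (2.38) at the all-zero datum
  have hVpp : W.Vpp = W.Vp := rfl
  have hQ0 : ∀ Y φ b b', W.toStepData.Q Y φ b b' = 0 := fun _ _ _ _ => rfl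
  have hrepr : B13.Repr142 W.toStepData := by
    intro Y φ _
    show (0 : ℂ) = W.toStepData.quadForm Y φ + 0
    simp [B13.StepData.quadForm, hQ0]
  have h143 : B13.Bound143 W.toStepData consts := by
    intro Y φ b b' _
    show ‖(0 : ℂ)‖ ≤ _
    rw [norm_zero]
    refine mul_nonneg ?_ (Real.exp_pos _).le
    show (0 : ℝ) ≤ 1 * ε₁t * (κw + 1) ^ 4 * Real.exp (1 * κ₁t)
    positivity
  have hVan : ∀ Y, W.Analytic (W.V Y) (W.sp1 Y) := fun _ => trivial
  have hG : ∀ Y, W.GaugeInv (W.V Y) ∧ W.GaugeInv (W.toStepData.quadForm Y) ∧ W.GaugeInv (W.Vpp Y) :=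
    fun _ => ⟨trivial, trivial, trivial⟩
  have h238 : B13.Bound238 W.toStepData consts := by
    intro Z φ _
    show ‖(0 : ℂ)‖ ≤ _
    rw [norm_zero]
    have hC3 : 0 ≤ consts.C3act * consts.ε₁ := by
      have hK : 0 < Kw := K₀_pos 64 8
      have hα : 0 < α₆w := by unfold α₆w; positivity
      have hAup : 0 < Aup := by unfold Aup; positivity
      have hA₁ : 0 < A₁w := by unfold A₁w; positivity
      unfold B13.Consts.C3act B13.Consts.K₀
      show (0 : ℝ) ≤ 2 * (((8 : ℕ) : ℝ) + 2) ^ 4 * A₁w * (2 * (2 * 1 * (1 : ℝ)⁻¹ * α₆w⁻¹ * (κw + 1) ^ (0 : ℕ) *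
        Real.exp (1 * κ₁t))) * ε₁t
      positivity
    exact mul_nonneg hC3 (Real.exp_pos _).le
  exact ⟨W, b13Leaf_twoTorus W consts h1 hVpp hrepr h143 hVan hG h238⟩

end Literature.MathematicalPhysics.QuantumFieldTheory.Balaban1983to89.B13NodeTorusConsts
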